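import Summits.ABC.IUTFork.LDHGenuinePerImageAllLevels
import HarnessLib

/-!
# The fork at [IUTchIII] Corollary 3.12, L-DH level, READING (P): the per-image Corollary AS TYPED at EVERY PRIME LEVEL `l ≥ 5`
# for `7³ + 3¹⁰ = 2¹¹·29` and `73 + 2¹³·7⁷·941² = 3¹⁶·103³·127` (abc-iut cell, branch C, row «C:PERIMAGE-P-ALL-LEVELS», file 2 of 3)

Record-only PROOF file (D-0012) of the abc-iut cell (branch-C certificate seat abc-iut-C-cert-2, gen 6; crux ThetaPartII =
stmt-ABC-19678). TAKES NO SIDE on [IUTchIII] Cor. 3.12 or on any author. File 1 (`LDHGenuinePerImageAllLevels`) proved the closed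
form `cor312PerImageOf_ratPoint_sharp_closedForm` of abc-iut-c312-d1's sharpened rational-point test (p484321), uniform in the level
`l` and covering `l ∈ I`, and its monotonicity `weights_mono_seven`. HERE it is run on two of the three remaining tabulated triples of
the cell's books, whose `l`-axis had no uniform theorem (the third, `1 + 3¹⁶·7`, is file 3): **`Frey343.cor312PerImageOf_all`**
(`λ = 343/59392`) and **`Frey73.cor312PerImageOf_all`** (`λ = 73/5973865915867209`): for EVERY prime `l ≥ 7` and EVERY genuine Θ-volume
datum `T` of `(λ, l)`, `T.Cor312PerImageOf` — NO hypothesis; per triple ONE integer certificate at `l = 7` (`π > 3`) + `weights_mono_seven`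
for every prime `l ∉ I`, one certificate per pole level `l ∈ I`, `l ≥ 7`, except the landed unconditional levels `(7³+3¹⁰, 29)`,
`(73-triple, 73)`, `(73-triple, 127)` of abc-iut-c312-d1 / `LDHGenuinePerImageUnconditional` (primed forms), consumed BY NAME. Then the
level `l = 5` by abc-iut-c312-d1's `(1 − 1/l)`-weighted rational test `cor312PerImageOf_ratPoint_of_le` (valid from `l = 5`) and
**`Frey343.cor312PerImageOf_every`** / **`Frey73.cor312PerImageOf_every`**: EVERY prime `l ≥ 5` — the full `l`-range of the books' binders
(`l.Prime → 5 ≤ l`). Certificates ≤ 16 digits; desk margins ≥ 2.9 nats (seat folder `gen_certs.py`).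

READING (neutral; branch-C books): positive reading-(P) instances (`hNumPOffBad` of p462946 and its M twin have a TRUE conclusion)
on the whole prime `l`-axis `l ≥ 7` at these `λ`, next to ruling C-R80's (U) instances; no certificate's hypothesis count moves.
HONEST SCOPE: OUR typed per-image inequality, (Ind2) = the cell's full lattice-automorphism typing (Dupuy–Hilado §4.9); nothing about
print's (Ind2) or the printed inequality; nothing asserts that genuine data exist at any `(λ, l)`, Cor. 3.12 in general, or abc;
proved-as-typed ≠ in print; typed ≠ proved. [cite: Mochizuki2012, IUTchIII Cor. 3.12 p. 173–174, proof Step (x) p. 181; IUTchIV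
Thm. 1.10 p. 22–24, Step (v) p. 27–29, Cor. 2.2 (ii) proof (P5) p. 46] [cite: SilvermanAEC2009, Prop. III.1.7(b)]
[cite: DupuyHilado2025, §4.9, §4.12] [claim: Mochizuki2012, status: disputed] for every IUT quotation. PROOF-ONLY: no definitions,
no new `Prop`.
-/

noncomputable section

namespace Literature.IUT.LogVolume.Cor22

open NumberField IsDedekindDomain Ideal Module Literature.NumberTheory.DiophantineGeometry
open Literature.NumberTheory.DiophantineGeometry.GenEll Summit.ABC.IUTFork Literature.IUT.HodgeTheaters

/-! ### `7³ + 3¹⁰ = 2¹¹·29` (`λ = 343/ 59392`; `I = {2, 3, 7, 29}`, `c = 5`) -/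

namespace Frey343

/-- The primes of the reduced denominator of `j(λ)`. [folklore] -/
private theorem primes : ∀ p ∈ ({2, 3, 7, 29} : Finset ℕ), p.Prime := by
  intro p hp
  simp only [Finset.mem_insert, Finset.mem_singleton] at hp
  rcases hp with rfl | rfl | rfl | rfl <;> norm_num

/-- The exponents are positive. [folklore] -/
private theorem exp_ne_zero : ∀ p ∈ ({2, 3, 7, 29} : Finset ℕ), (fun p => if p = 2 then 14 else if p = 3 then 20 else if p = 7 then 6 else 2) p ≠ 0 := by
  intro p hp
  simp only [Finset.mem_insert, Finset.mem_singleton] at hp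
  rcases hp with rfl | rfl | rfl | rfl <;> norm_num

/-- The factorised denominator. [folklore] -/
private theorem den : (5652352909513890349056 : ℕ) = ∏ p ∈ ({2, 3, 7, 29} : Finset ℕ), p ^ (fun p => if p = 2 then 14 else if p = 3 then 20 else if p = 7 then 6 else 2) p := by
  rw [Finset.prod_insert (by decide), Finset.prod_insert (by decide), Finset.prod_insert (by decide), Finset.prod_singleton]
  norm_num

/-- The numerator is prime to every prime of the denominator. [folklore] -/
private theorem coprime : ∀ p ∈ ({2, 3, 7, 29} : Finset ℕ), ¬ p ∣ (43138515777213631193352207793 : ℕ) := by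
  intro p hp
  simp only [Finset.mem_insert, Finset.mem_singleton] at hp
  rcases hp with rfl | rfl | rfl | rfl <;> norm_num

/-- The constant `c = 5` is below every `lcm(30/gcd(30,e_p), c_p)`, `p` odd. [folklore] -/
private theorem c_le : ∀ p ∈ ({2, 3, 7, 29} : Finset ℕ), p ≠ 2 →
    5 ≤ Nat.lcm (30 / Nat.gcd 30 ((fun p => if p = 2 then 14 else if p = 3 then 20 else if p = 7 then 6 else 2) p)) (if p = 3 then 2 else if p = 5 then 4 else 1) := by
  intro p hp
  simp only [Finset.mem_insert, Finset.mem_singleton] at hp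
  rcases hp with rfl | rfl | rfl | rfl <;> decide

/-- `Q = Σ_{p odd} e_p·log p`. [folklore] -/
private theorem sumQ : ∑ p ∈ ({2, 3, 7, 29} : Finset ℕ).erase 2, (((fun p => if p = 2 then 14 else if p = 3 then 20 else if p = 7 then 6 else 2) p : ℕ) : ℝ) * Real.log p = 20 * Real.log 3 + 6 * Real.log 7 + 2 * Real.log 29 := by
  rw [show ({2, 3, 7, 29} : Finset ℕ).erase 2 = ({3, 7, 29} : Finset ℕ) by decide, Finset.sum_insert (by decide), Finset.sum_insert (by decide), Finset.sum_singleton]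
  norm_num
  ring

/-- `R = Σ_{p odd} log p`. [folklore] -/
private theorem sumR : ∑ p ∈ ({2, 3, 7, 29} : Finset ℕ).erase 2, Real.log p = Real.log 3 + Real.log 7 + Real.log 29 := by
  rw [show ({2, 3, 7, 29} : Finset ℕ).erase 2 = ({3, 7, 29} : Finset ℕ) by decide, Finset.sum_insert (by decide), Finset.sum_insert (by decide), Finset.sum_singleton]
  push_cast
  ring

/-- **Level `l = 7`** (`l ∈ I`): `T.Cor312PerImageOf` at every genuine Θ-datum of `7³ + 3¹⁰ = 2¹¹·29` — NO hypothesis; closed form,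
certificate `3^3 ≤ 2·5·7·29`, `π > 3` (margin ≈ 3.87 nats). [cite: Mochizuki2012, IUTchIII Cor. 3.12 p. 173–174] [claim: Mochizuki2012, status: disputed] -/
theorem cor312PerImageOf_seven (T : ThetaVolumeDatumAt (ratPoint ((343 : ℚ) / 59392)) 7) : T.Cor312PerImageOf := by
  have hpi : Real.log 3 < Real.log Real.pi := Real.log_lt_log (by norm_num) Real.pi_gt_three
  have hp2 : 0 < Real.log 2 := Real.log_pos (by norm_num); have hp3 : 0 < Real.log 3 := Real.log_pos (by norm_num); have hp5 : 0 < Real.log 5 := Real.log_pos (by norm_num); have hp7 : 0 < Real.log 7 := Real.log_pos (by norm_num); have hp29 : 0 < Real.log 29 := Real.log_pos (by norm_num)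
  refine cor312PerImageOf_ratPoint_sharp_closedForm (q := (343 : ℚ) / 59392) (by norm_num) (by norm_num) (by norm_num) (by norm_num)
    primes exp_ne_zero den jInv_freyA (by norm_num) coprime (le_of_eq sumQ) (le_of_eq sumR.symm) 5 (by norm_num) c_le ?_ T
  have hZ : (3 ^ 3 : ℕ) ≤ 2 * 5 * 7 * 29 := by norm_num
  have hR : ((3 : ℝ) ^ 3) ≤ (2 : ℝ) * (5 : ℝ) * (7 : ℝ) * (29 : ℝ) := by exact_mod_cast hZ
  have hlog := Real.log_le_log (by positivity) hR
  repeat rw [Real.log_mul (by positivity) (by positivity)] at hlog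
  simp only [Real.log_pow] at hlog; push_cast at hlog ⊢; norm_num
  linarith [hlog, hpi, hp2, hp3, hp5, hp7, hp29]

/-- **[IUTchIII] COR. 3.12 IN READING (P), AS TYPED, HOLDS AT EVERY GENUINE Θ-DATUM OF `7³ + 3¹⁰ = 2¹¹·29` AT EVERY PRIME LEVEL
`l ≥ 7`** — no hypothesis. Off `I`: the closed form of §1 at `l = 7` (one certificate, `π > 3`) and `weights_mono_seven`;
`l = 7`: the closed form at the level; `l = 29`: the landed unconditional levels BY NAME.
[cite: Mochizuki2012, IUTchIII Cor. 3.12 p. 173–174; IUTchIV Thm. 1.10 Step (v) p. 27–29] [claim: Mochizuki2012, status: disputed] -/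
theorem cor312PerImageOf_all {l : ℕ} (hl : l.Prime) (h7 : 7 ≤ l)
    (T : ThetaVolumeDatumAt (ratPoint ((343 : ℚ) / 59392)) l) : T.Cor312PerImageOf := by
  by_cases hlI : l ∈ ({2, 3, 7, 29} : Finset ℕ)
  · have hlI' := hlI
    simp only [Finset.mem_insert, Finset.mem_singleton] at hlI'
    rcases hlI' with rfl | rfl | rfl | rfl
    · omega
    · omega
    · exact cor312PerImageOf_seven T
    · exact cor312PerImageOf_freyA_twentynine' T
  · -- `l ∉ I`: the closed form at `l = 7` (margin ≈ 3.82 nats) and monotonicity in `l`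
    have hpi : Real.log 3 < Real.log Real.pi := Real.log_lt_log (by norm_num) Real.pi_gt_three
    have hp2 : 0 < Real.log 2 := Real.log_pos (by norm_num); have hp3 : 0 < Real.log 3 := Real.log_pos (by norm_num); have hp5 : 0 < Real.log 5 := Real.log_pos (by norm_num); have hp7 : 0 < Real.log 7 := Real.log_pos (by norm_num); have hp29 : 0 < Real.log 29 := Real.log_pos (by norm_num)
    refine cor312PerImageOf_ratPoint_sharp_closedForm (q := (343 : ℚ) / 59392) (by norm_num) (by norm_num) hl h7
      primes exp_ne_zero den jInv_freyA (by norm_num) coprime (le_of_eq sumQ) (le_of_eq sumR.symm) 5 (by norm_num) c_le ?_ T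
    rw [if_neg hlI, if_neg hlI]
    simp only [sub_zero]
    have h3I : (3 : ℕ) ∈ ({2, 3, 7, 29} : Finset ℕ) := by decide
    have h5I : (5 : ℕ) ∉ ({2, 3, 7, 29} : Finset ℕ) := by decide
    rw [if_pos h3I, if_neg h5I]
    have hmono := weights_mono_seven h7 (c := (5 : ℝ)) (by norm_num)
      (R := Real.log 3 + Real.log 7 + Real.log 29) (by positivity)
    have hZ : (3 ^ 3 : ℕ) ≤ 2 * 5 * 7 * 29 := by norm_num
    have hR : ((3 : ℝ) ^ 3) ≤ (2 : ℝ) * (5 : ℝ) * (7 : ℝ) * (29 : ℝ) := by exact_mod_cast hZ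
    have hlog := Real.log_le_log (by positivity) hR
    repeat rw [Real.log_mul (by positivity) (by positivity)] at hlog
    simp only [Real.log_pow] at hlog; push_cast at hlog hmono ⊢
    linarith [hlog, hpi, hmono, hp2, hp3, hp5, hp7, hp29]

/-- `log q^{∤{2,5}}(λ)` exactly. [cite: Mochizuki2012, IUTchIV Thm 1.10 p.23] [claim: Mochizuki2012, status: disputed] -/
theorem logQAvoid_five : logQAvoid (ratPoint ((343 : ℚ) / 59392)) {2, 5} = 20 * Real.log 3 + 6 * Real.log 7 + 2 * Real.log 29 := by
  have h := logQAvoid_ratPoint_eq_sum primes exp_ne_zero den jInv_freyA (by norm_num) {2, 5} (fun p hp _ => coprime p hp)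
  rw [Finset.sum_filter] at h
  norm_num [Finset.sum_insert] at h
  linarith [h]

/-- `log 𝔣^{∤{2,5}}(λ)` exactly. [cite: Mochizuki2012, IUTchIV Thm 1.10 p.23] [claim: Mochizuki2012, status: disputed] -/
theorem logCondAvoid_five : logCondAvoid (ratPoint ((343 : ℚ) / 59392)) {2, 5} = Real.log 3 + Real.log 7 + Real.log 29 := by
  have h := logCondAvoid_ratPoint_eq_sum primes exp_ne_zero den jInv_freyA (by norm_num) {2, 5} (fun p hp _ => coprime p hp)
  rw [Finset.sum_filter] at h
  norm_num [Finset.sum_insert] at h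
  linarith [h]

/-- **Level `l = 5`**: `T.Cor312PerImageOf` at every genuine Θ-datum of `7³ + 3¹⁰ = 2¹¹·29` — NO hypothesis; abc-iut-c312-d1's `(1 − 1/l)`-weighted
rational test `cor312PerImageOf_ratPoint_of_le` (`LDHGenuinePerImageUnconditional`), termwise (`π > 3`, `log p > 0`) (margin ≈ 6.31 nats).
[cite: Mochizuki2012, IUTchIII Cor. 3.12 p. 173–174] [claim: Mochizuki2012, status: disputed] -/
theorem cor312PerImageOf_five (T : ThetaVolumeDatumAt (ratPoint ((343 : ℚ) / 59392)) 5) : T.Cor312PerImageOf := by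
  have hpi : Real.log 3 < Real.log Real.pi := Real.log_lt_log (by norm_num) Real.pi_gt_three
  have hp2 : 0 < Real.log 2 := Real.log_pos (by norm_num); have hp3 : 0 < Real.log 3 := Real.log_pos (by norm_num); have hp5 : 0 < Real.log 5 := Real.log_pos (by norm_num); have hp7 : 0 < Real.log 7 := Real.log_pos (by norm_num); have hp29 : 0 < Real.log 29 := Real.log_pos (by norm_num)
  refine cor312PerImageOf_ratPoint_of_le (q := (343 : ℚ) / 59392) (by norm_num) (by norm_num) (by norm_num) (by norm_num) ?_ T
  rw [logQAvoid_five, logCondAvoid_five]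
  norm_num
  linarith [hpi, hp2, hp3, hp5, hp7, hp29]

/-- **EVERY PRIME LEVEL `l ≥ 5`** — the full `l`-range of the books' binders (`l.Prime → 5 ≤ l`): `T.Cor312PerImageOf` at every genuine
Θ-datum of `7³ + 3¹⁰ = 2¹¹·29`, NO hypothesis (`l = 5` here; `l ≥ 7` = `cor312PerImageOf_all`). [cite: Mochizuki2012, IUTchIII Cor. 3.12
p. 173–174] [claim: Mochizuki2012, status: disputed] -/
theorem cor312PerImageOf_every {l : ℕ} (hl : l.Prime) (h5 : 5 ≤ l)
    (T : ThetaVolumeDatumAt (ratPoint ((343 : ℚ) / 59392)) l) : T.Cor312PerImageOf := by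
  by_cases h7 : 7 ≤ l
  · exact cor312PerImageOf_all hl h7 T
  · interval_cases l
    · exact cor312PerImageOf_five T
    · exact absurd hl (by norm_num)

end Frey343

/-! ### `73 + 2¹³·7⁷·941² = 3¹⁶·103³·127` (`λ = 73/ 5973865915867209`; `I = {2, 3, 7, 73, 103, 127, 941}`, `c = 5`) -/

namespace Frey73

/-- The primes of the reduced denominator of `j(λ)`. [folklore] -/
private theorem primes : ∀ p ∈ ({2, 3, 7, 73, 103, 127, 941} : Finset ℕ), p.Prime := by
  intro p hp
  simp only [Finset.mem_insert, Finset.mem_singleton] at hp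
  rcases hp with rfl | rfl | rfl | rfl | rfl | rfl | rfl <;> norm_num

/-- The exponents are positive. [folklore] -/
private theorem exp_ne_zero : ∀ p ∈ ({2, 3, 7, 73, 103, 127, 941} : Finset ℕ), (fun p => if p = 2 then 18 else if p = 3 then 32 else if p = 7 then 14 else if p = 73 then 2 else if p = 103 then 6 else if p = 127 then 2 else 4) p ≠ 0 := by
  intro p hp
  simp only [Finset.mem_insert, Finset.mem_singleton] at hp
  rcases hp with rfl | rfl | rfl | rfl | rfl | rfl | rfl <;> norm_num

/-- The factorised denominator. [folklore] -/
private theorem den : (26511093248294605271825669617380779072819273066893858039912464384 : ℕ) = ∏ p ∈ ({2, 3, 7, 73, 103, 127, 941} : Finset ℕ), p ^ (fun p => if p = 2 then 18 else if p = 3 then 32 else if p = 7 then 14 else if p = 73 then 2 else if p = 103 then 6 else if p = 127 then 2 else 4) p := by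
  rw [Finset.prod_insert (by decide), Finset.prod_insert (by decide), Finset.prod_insert (by decide), Finset.prod_insert (by decide), Finset.prod_insert (by decide), Finset.prod_insert (by decide), Finset.prod_singleton]
  norm_num

/-- The numerator is prime to every prime of the denominator. [folklore] -/
private theorem coprime : ∀ p ∈ ({2, 3, 7, 73, 103, 127, 941} : Finset ℕ), ¬ p ∣ (45449888645534293560208774126106520237888398973563513334184714992571069114957952465292215953777 : ℕ) := by
  intro p hp
  simp only [Finset.mem_insert, Finset.mem_singleton] at hp
  rcases hp with rfl | rfl | rfl | rfl | rfl | rfl | rfl <;> norm_num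

/-- The constant `c = 5` is below every `lcm(30/gcd(30,e_p), c_p)`, `p` odd. [folklore] -/
private theorem c_le : ∀ p ∈ ({2, 3, 7, 73, 103, 127, 941} : Finset ℕ), p ≠ 2 →
    5 ≤ Nat.lcm (30 / Nat.gcd 30 ((fun p => if p = 2 then 18 else if p = 3 then 32 else if p = 7 then 14 else if p = 73 then 2 else if p = 103 then 6 else if p = 127 then 2 else 4) p)) (if p = 3 then 2 else if p = 5 then 4 else 1) := by
  intro p hp
  simp only [Finset.mem_insert, Finset.mem_singleton] at hp
  rcases hp with rfl | rfl | rfl | rfl | rfl | rfl | rfl <;> decide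

/-- `Q = Σ_{p odd} e_p·log p`. [folklore] -/
private theorem sumQ : ∑ p ∈ ({2, 3, 7, 73, 103, 127, 941} : Finset ℕ).erase 2, (((fun p => if p = 2 then 18 else if p = 3 then 32 else if p = 7 then 14 else if p = 73 then 2 else if p = 103 then 6 else if p = 127 then 2 else 4) p : ℕ) : ℝ) * Real.log p = 32 * Real.log 3 + 14 * Real.log 7 + 2 * Real.log 73 + 6 * Real.log 103 + 2 * Real.log 127 + 4 * Real.log 941 := by
  rw [show ({2, 3, 7, 73, 103, 127, 941} : Finset ℕ).erase 2 = ({3, 7, 73, 103, 127, 941} : Finset ℕ) by decide, Finset.sum_insert (by decide), Finset.sum_insert (by decide), Finset.sum_insert (by decide), Finset.sum_insert (by decide), Finset.sum_insert (by decide), Finset.sum_singleton]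
  norm_num
  ring

/-- `R = Σ_{p odd} log p`. [folklore] -/
private theorem sumR : ∑ p ∈ ({2, 3, 7, 73, 103, 127, 941} : Finset ℕ).erase 2, Real.log p = Real.log 3 + Real.log 7 + Real.log 73 + Real.log 103 + Real.log 127 + Real.log 941 := by
  rw [show ({2, 3, 7, 73, 103, 127, 941} : Finset ℕ).erase 2 = ({3, 7, 73, 103, 127, 941} : Finset ℕ) by decide, Finset.sum_insert (by decide), Finset.sum_insert (by decide), Finset.sum_insert (by decide), Finset.sum_insert (by decide), Finset.sum_insert (by decide), Finset.sum_singleton]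
  push_cast
  ring

/-- **Level `l = 7`** (`l ∈ I`): `T.Cor312PerImageOf` at every genuine Θ-datum of `73 + 2¹³·7⁷·941² = 3¹⁶·103³·127` — NO hypothesis; closed form,
certificate `3^7·103 ≤ 2·5·7·73·127`, `π > 3` (margin ≈ 7.31 nats). [cite: Mochizuki2012, IUTchIII Cor. 3.12 p. 173–174] [claim: Mochizuki2012, status: disputed] -/
theorem cor312PerImageOf_seven (T : ThetaVolumeDatumAt (ratPoint ((73 : ℚ) / 5973865915867209)) 7) : T.Cor312PerImageOf := by
  have hpi : Real.log 3 < Real.log Real.pi := Real.log_lt_log (by norm_num) Real.pi_gt_three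
  have hp2 : 0 < Real.log 2 := Real.log_pos (by norm_num); have hp3 : 0 < Real.log 3 := Real.log_pos (by norm_num); have hp5 : 0 < Real.log 5 := Real.log_pos (by norm_num); have hp7 : 0 < Real.log 7 := Real.log_pos (by norm_num); have hp73 : 0 < Real.log 73 := Real.log_pos (by norm_num); have hp103 : 0 < Real.log 103 := Real.log_pos (by norm_num); have hp127 : 0 < Real.log 127 := Real.log_pos (by norm_num); have hp941 : 0 < Real.log 941 := Real.log_pos (by norm_num)
  refine cor312PerImageOf_ratPoint_sharp_closedForm (q := (73 : ℚ) / 5973865915867209) (by norm_num) (by norm_num) (by norm_num) (by norm_num)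
    primes exp_ne_zero den jInv_freyF (by norm_num) coprime (le_of_eq sumQ) (le_of_eq sumR.symm) 5 (by norm_num) c_le ?_ T
  have hZ : (3 ^ 7 * 103 : ℕ) ≤ 2 * 5 * 7 * 73 * 127 := by norm_num
  have hR : ((3 : ℝ) ^ 7 * (103 : ℝ)) ≤ (2 : ℝ) * (5 : ℝ) * (7 : ℝ) * (73 : ℝ) * (127 : ℝ) := by exact_mod_cast hZ
  have hlog := Real.log_le_log (by positivity) hR
  repeat rw [Real.log_mul (by positivity) (by positivity)] at hlog
  simp only [Real.log_pow] at hlog; push_cast at hlog ⊢; norm_num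
  linarith [hlog, hpi, hp2, hp3, hp5, hp7, hp73, hp103, hp127, hp941]

/-- **Level `l = 103`** (`l ∈ I`): `T.Cor312PerImageOf` at every genuine Θ-datum of `73 + 2¹³·7⁷·941² = 3¹⁶·103³·127` — NO hypothesis; closed form,
certificate `3^7·7^3 ≤ 2·5·73·103·127`, `π > 3` (margin ≈ 8.27 nats). [cite: Mochizuki2012, IUTchIII Cor. 3.12 p. 173–174] [claim: Mochizuki2012, status: disputed] -/
theorem cor312PerImageOf_onehundredthree (T : ThetaVolumeDatumAt (ratPoint ((73 : ℚ) / 5973865915867209)) 103) : T.Cor312PerImageOf := by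
  have hpi : Real.log 3 < Real.log Real.pi := Real.log_lt_log (by norm_num) Real.pi_gt_three
  have hp2 : 0 < Real.log 2 := Real.log_pos (by norm_num); have hp3 : 0 < Real.log 3 := Real.log_pos (by norm_num); have hp5 : 0 < Real.log 5 := Real.log_pos (by norm_num); have hp7 : 0 < Real.log 7 := Real.log_pos (by norm_num); have hp73 : 0 < Real.log 73 := Real.log_pos (by norm_num); have hp103 : 0 < Real.log 103 := Real.log_pos (by norm_num); have hp127 : 0 < Real.log 127 := Real.log_pos (by norm_num); have hp941 : 0 < Real.log 941 := Real.log_pos (by norm_num)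
  refine cor312PerImageOf_ratPoint_sharp_closedForm (q := (73 : ℚ) / 5973865915867209) (by norm_num) (by norm_num) (by norm_num) (by norm_num)
    primes exp_ne_zero den jInv_freyF (by norm_num) coprime (le_of_eq sumQ) (le_of_eq sumR.symm) 5 (by norm_num) c_le ?_ T
  have hZ : (3 ^ 7 * 7 ^ 3 : ℕ) ≤ 2 * 5 * 73 * 103 * 127 := by norm_num
  have hR : ((3 : ℝ) ^ 7 * (7 : ℝ) ^ 3) ≤ (2 : ℝ) * (5 : ℝ) * (73 : ℝ) * (103 : ℝ) * (127 : ℝ) := by exact_mod_cast hZ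
  have hlog := Real.log_le_log (by positivity) hR
  repeat rw [Real.log_mul (by positivity) (by positivity)] at hlog
  simp only [Real.log_pow] at hlog; push_cast at hlog ⊢; norm_num
  linarith [hlog, hpi, hp2, hp3, hp5, hp7, hp73, hp103, hp127, hp941]

/-- **Level `l = 941`** (`l ∈ I`): `T.Cor312PerImageOf` at every genuine Θ-datum of `73 + 2¹³·7⁷·941² = 3¹⁶·103³·127` — NO hypothesis; closed form,
certificate `3^7·7^3·103 ≤ 2·5·73·127·941`, `π > 3` (margin ≈ 8.27 nats). [cite: Mochizuki2012, IUTchIII Cor. 3.12 p. 173–174] [claim: Mochizuki2012, status: disputed] -/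
theorem cor312PerImageOf_ninefortyone (T : ThetaVolumeDatumAt (ratPoint ((73 : ℚ) / 5973865915867209)) 941) : T.Cor312PerImageOf := by
  have hpi : Real.log 3 < Real.log Real.pi := Real.log_lt_log (by norm_num) Real.pi_gt_three
  have hp2 : 0 < Real.log 2 := Real.log_pos (by norm_num); have hp3 : 0 < Real.log 3 := Real.log_pos (by norm_num); have hp5 : 0 < Real.log 5 := Real.log_pos (by norm_num); have hp7 : 0 < Real.log 7 := Real.log_pos (by norm_num); have hp73 : 0 < Real.log 73 := Real.log_pos (by norm_num); have hp103 : 0 < Real.log 103 := Real.log_pos (by norm_num); have hp127 : 0 < Real.log 127 := Real.log_pos (by norm_num); have hp941 : 0 < Real.log 941 := Real.log_pos (by norm_num)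
  refine cor312PerImageOf_ratPoint_sharp_closedForm (q := (73 : ℚ) / 5973865915867209) (by norm_num) (by norm_num) (by norm_num) (by norm_num)
    primes exp_ne_zero den jInv_freyF (by norm_num) coprime (le_of_eq sumQ) (le_of_eq sumR.symm) 5 (by norm_num) c_le ?_ T
  have hZ : (3 ^ 7 * 7 ^ 3 * 103 : ℕ) ≤ 2 * 5 * 73 * 127 * 941 := by norm_num
  have hR : ((3 : ℝ) ^ 7 * (7 : ℝ) ^ 3 * (103 : ℝ)) ≤ (2 : ℝ) * (5 : ℝ) * (73 : ℝ) * (127 : ℝ) * (941 : ℝ) := by exact_mod_cast hZ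
  have hlog := Real.log_le_log (by positivity) hR
  repeat rw [Real.log_mul (by positivity) (by positivity)] at hlog
  simp only [Real.log_pow] at hlog; push_cast at hlog ⊢; norm_num
  linarith [hlog, hpi, hp2, hp3, hp5, hp7, hp73, hp103, hp127, hp941]

/-- **[IUTchIII] COR. 3.12 IN READING (P), AS TYPED, HOLDS AT EVERY GENUINE Θ-DATUM OF `73 + 2¹³·7⁷·941² = 3¹⁶·103³·127` AT EVERY PRIME LEVEL
`l ≥ 7`** — no hypothesis. Off `I`: the closed form of §1 at `l = 7` (one certificate, `π > 3`) and `weights_mono_seven`;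
`l = 7`, `l = 103`, `l = 941`: the closed form at the level; `l = 73`, `l = 127`: the landed unconditional levels BY NAME.
[cite: Mochizuki2012, IUTchIII Cor. 3.12 p. 173–174; IUTchIV Thm. 1.10 Step (v) p. 27–29] [claim: Mochizuki2012, status: disputed] -/
theorem cor312PerImageOf_all {l : ℕ} (hl : l.Prime) (h7 : 7 ≤ l)
    (T : ThetaVolumeDatumAt (ratPoint ((73 : ℚ) / 5973865915867209)) l) : T.Cor312PerImageOf := by
  by_cases hlI : l ∈ ({2, 3, 7, 73, 103, 127, 941} : Finset ℕ)
  · have hlI' := hlI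
    simp only [Finset.mem_insert, Finset.mem_singleton] at hlI'
    rcases hlI' with rfl | rfl | rfl | rfl | rfl | rfl | rfl
    · omega
    · omega
    · exact cor312PerImageOf_seven T
    · exact cor312PerImageOf_freyF_seventythree' T
    · exact cor312PerImageOf_onehundredthree T
    · exact cor312PerImageOf_freyF_onetwentyseven' T
    · exact cor312PerImageOf_ninefortyone T
  · -- `l ∉ I`: the closed form at `l = 7` (margin ≈ 4.66 nats) and monotonicity in `l`
    have hpi : Real.log 3 < Real.log Real.pi := Real.log_lt_log (by norm_num) Real.pi_gt_three
    have hp2 : 0 < Real.log 2 := Real.log_pos (by norm_num); have hp3 : 0 < Real.log 3 := Real.log_pos (by norm_num); have hp5 : 0 < Real.log 5 := Real.log_pos (by norm_num); have hp7 : 0 < Real.log 7 := Real.log_pos (by norm_num); have hp73 : 0 < Real.log 73 := Real.log_pos (by norm_num); have hp103 : 0 < Real.log 103 := Real.log_pos (by norm_num); have hp127 : 0 < Real.log 127 := Real.log_pos (by norm_num); have hp941 : 0 < Real.log 941 := Real.log_pos (by norm_num)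
    refine cor312PerImageOf_ratPoint_sharp_closedForm (q := (73 : ℚ) / 5973865915867209) (by norm_num) (by norm_num) hl h7
      primes exp_ne_zero den jInv_freyF (by norm_num) coprime (le_of_eq sumQ) (le_of_eq sumR.symm) 5 (by norm_num) c_le ?_ T
    rw [if_neg hlI, if_neg hlI]
    simp only [sub_zero]
    have h3I : (3 : ℕ) ∈ ({2, 3, 7, 73, 103, 127, 941} : Finset ℕ) := by decide
    have h5I : (5 : ℕ) ∉ ({2, 3, 7, 73, 103, 127, 941} : Finset ℕ) := by decide
    rw [if_pos h3I, if_neg h5I]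
    have hmono := weights_mono_seven h7 (c := (5 : ℝ)) (by norm_num)
      (R := Real.log 3 + Real.log 7 + Real.log 73 + Real.log 103 + Real.log 127 + Real.log 941) (by positivity)
    have hZ : (3 ^ 14 * 7 ^ 3 * 103 : ℕ) ≤ 2 ^ 2 * 5 ^ 3 * 73 ^ 2 * 127 ^ 2 * 941 := by norm_num
    have hR : ((3 : ℝ) ^ 14 * (7 : ℝ) ^ 3 * (103 : ℝ)) ≤ (2 : ℝ) ^ 2 * (5 : ℝ) ^ 3 * (73 : ℝ) ^ 2 * (127 : ℝ) ^ 2 * (941 : ℝ) := by exact_mod_cast hZ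
    have hlog := Real.log_le_log (by positivity) hR
    repeat rw [Real.log_mul (by positivity) (by positivity)] at hlog
    simp only [Real.log_pow] at hlog; push_cast at hlog hmono ⊢
    linarith [hlog, hpi, hmono, hp2, hp3, hp5, hp7, hp73, hp103, hp127, hp941]

/-- `log q^{∤{2,5}}(λ)` exactly. [cite: Mochizuki2012, IUTchIV Thm 1.10 p.23] [claim: Mochizuki2012, status: disputed] -/
theorem logQAvoid_five : logQAvoid (ratPoint ((73 : ℚ) / 5973865915867209)) {2, 5} = 32 * Real.log 3 + 14 * Real.log 7 + 2 * Real.log 73 + 6 * Real.log 103 + 2 * Real.log 127 + 4 * Real.log 941 := by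
  have h := logQAvoid_ratPoint_eq_sum primes exp_ne_zero den jInv_freyF (by norm_num) {2, 5} (fun p hp _ => coprime p hp)
  rw [Finset.sum_filter] at h
  norm_num [Finset.sum_insert] at h
  linarith [h]

/-- `log 𝔣^{∤{2,5}}(λ)` exactly. [cite: Mochizuki2012, IUTchIV Thm 1.10 p.23] [claim: Mochizuki2012, status: disputed] -/
theorem logCondAvoid_five : logCondAvoid (ratPoint ((73 : ℚ) / 5973865915867209)) {2, 5} = Real.log 3 + Real.log 7 + Real.log 73 + Real.log 103 + Real.log 127 + Real.log 941 := by
  have h := logCondAvoid_ratPoint_eq_sum primes exp_ne_zero den jInv_freyF (by norm_num) {2, 5} (fun p hp _ => coprime p hp)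
  rw [Finset.sum_filter] at h
  norm_num [Finset.sum_insert] at h
  linarith [h]

/-- **Level `l = 5`**: `T.Cor312PerImageOf` at every genuine Θ-datum of `73 + 2¹³·7⁷·941² = 3¹⁶·103³·127` — NO hypothesis; abc-iut-c312-d1's `(1 − 1/l)`-weighted
rational test `cor312PerImageOf_ratPoint_of_le` (`LDHGenuinePerImageUnconditional`), certificate `3^3·7^2 ≤ 5^2·73·127·941`, `π > 3` (margin ≈ 12.69 nats).
[cite: Mochizuki2012, IUTchIII Cor. 3.12 p. 173–174] [claim: Mochizuki2012, status: disputed] -/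
theorem cor312PerImageOf_five (T : ThetaVolumeDatumAt (ratPoint ((73 : ℚ) / 5973865915867209)) 5) : T.Cor312PerImageOf := by
  have hpi : Real.log 3 < Real.log Real.pi := Real.log_lt_log (by norm_num) Real.pi_gt_three
  have hp2 : 0 < Real.log 2 := Real.log_pos (by norm_num); have hp3 : 0 < Real.log 3 := Real.log_pos (by norm_num); have hp5 : 0 < Real.log 5 := Real.log_pos (by norm_num); have hp7 : 0 < Real.log 7 := Real.log_pos (by norm_num); have hp73 : 0 < Real.log 73 := Real.log_pos (by norm_num); have hp103 : 0 < Real.log 103 := Real.log_pos (by norm_num); have hp127 : 0 < Real.log 127 := Real.log_pos (by norm_num); have hp941 : 0 < Real.log 941 := Real.log_pos (by norm_num)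
  refine cor312PerImageOf_ratPoint_of_le (q := (73 : ℚ) / 5973865915867209) (by norm_num) (by norm_num) (by norm_num) (by norm_num) ?_ T
  rw [logQAvoid_five, logCondAvoid_five]
  have hZ : (3 ^ 3 * 7 ^ 2 : ℕ) ≤ 5 ^ 2 * 73 * 127 * 941 := by norm_num
  have hR : ((3 : ℝ) ^ 3 * (7 : ℝ) ^ 2) ≤ (5 : ℝ) ^ 2 * (73 : ℝ) * (127 : ℝ) * (941 : ℝ) := by exact_mod_cast hZ
  have hlog := Real.log_le_log (by positivity) hR
  repeat rw [Real.log_mul (by positivity) (by positivity)] at hlog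
  simp only [Real.log_pow] at hlog; push_cast at hlog ⊢; norm_num
  linarith [hlog, hpi, hp2, hp3, hp5, hp7, hp73, hp103, hp127, hp941]

/-- **EVERY PRIME LEVEL `l ≥ 5`** — the full `l`-range of the books' binders (`l.Prime → 5 ≤ l`): `T.Cor312PerImageOf` at every genuine
Θ-datum of `73 + 2¹³·7⁷·941² = 3¹⁶·103³·127`, NO hypothesis (`l = 5` here; `l ≥ 7` = `cor312PerImageOf_all`). [cite: Mochizuki2012, IUTchIII Cor. 3.12
p. 173–174] [claim: Mochizuki2012, status: disputed] -/
theorem cor312PerImageOf_every {l : ℕ} (hl : l.Prime) (h5 : 5 ≤ l)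
    (T : ThetaVolumeDatumAt (ratPoint ((73 : ℚ) / 5973865915867209)) l) : T.Cor312PerImageOf := by
  by_cases h7 : 7 ≤ l
  · exact cor312PerImageOf_all hl h7 T
  · interval_cases l
    · exact cor312PerImageOf_five T
    · exact absurd hl (by norm_num)

end Frey73

end Literature.IUT.LogVolume.Cor22

end
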